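import Mathlib
import HarnessLib
import Summits.QuantumAdvantage.QuantumAdvantage.Theses.AmplitudeProofs
import Literature.Computability.MetaComplexity.ProofSystemsProofs
import Literature.Computability.Complexity.ReductionsProofs
import Literature.Computability.Complexity.BrickAlgebra
import Literature.Computability.Complexity.Promise
import Literature.Computability.Cryptography.ClassBQP

/-!
# Route AmplitudeProofs — glue of the typed split of the deciding crux `ApcThesis` (stmt-QuantumAdvantage-2697)

Strategist decomposition (BC2 redirect, human ruling 2026-08-16) of the negation-side frame
`ApcThesis` ≡ "PromiseBQP ⊆ PromiseP in Cook–Reckhow form" along the field's seam *polynomially bounded* /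
*automatizable*:

* X₁ `ApcPolyBounded` (crux): Cook–Reckhow form of `PromiseBQP ⊆ PromiseNP` — a sound polynomial-time amplitude
  verifier with polynomially SHORT proofs on the `2/3`-promise (no finder);
* X₂ `ApcCertifiedCollapse` (crux): `PromiseBQP ∩ PromiseNP ⊆ PromiseP` — no quantum advantage on NP-certifiable
  promise problems;
* X₃ `ApcUniversal` (support, true in print): a universal gap-preserving uniform oracle-free Clifford+T family on
  instance codes `⟨⟨C⟩, x⟩ = boolPair (sigmaEncode ⟨n,m,C⟩) x`.

Main result `apcThesis_of_subs : X₁ → X₂ → X₃ → ApcThesis` (hypotheses verbatim, children order), via the gap-acceptance promise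
problem `apcPromise` and the two lemmas `apcPromise_mem_PromiseBQP` (from X₃) and `apcPromise_mem_PromiseNP`
(from X₁: the language of short `V`-proofs is in `NP`, re-pairing machine `polyTimeComputable_boolUnpair`,
pattern of `hasPolyBoundedProofSystem_iff_mem_NP_holds`).  The registered skeleton
`Cruxes/ApcThesis/Lines/np_cut.lean` is this proof with the three hypotheses as stubs.

References: Cook–Reckhow 1979 §1 Prop. 1.4 [CookReckhow1979]; Watrous 2009 §III.2 (PromiseBQP) [Watrous2009];
Goldreich 2006 Def. 1.2–1.3 (promise classes) [Goldreich2006].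
-/

namespace Summit.QuantumAdvantage.QuantumAdvantage.Theorems

open _root_.Computability Literature.Computability.Complexity Literature.Computability.Complexity.Classes
  Literature.Computability.Complexity.Nondeterministic Literature.Computability.MetaComplexity
  Literature.Computability.Cryptography
open Summit.QuantumAdvantage.QuantumAdvantage.Theses.AmplitudeProofs

/-- The gap-acceptance promise problem of oracle-free Clifford+T circuits (instances `⟨⟨n,m,C⟩, x⟩`):
yes = acceptance `≥ 2/3`, no = acceptance `≤ 1/3`. [cite: Watrous2009, §III.2] -/
def apcPromise : PromiseProblem where
  yes := {s | ∃ (n m : ℕ) (C : QCircuit cliffordT (n + m)) (x : QReg n), C.IsOracleFree ∧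
    s = boolPair (QCircuit.sigmaEncode ⟨n, m, C⟩) (List.ofFn x) ∧ (2 : ℝ) / 3 ≤ C.acceptProb 0 x}
  no := {s | ∃ (n m : ℕ) (C : QCircuit cliffordT (n + m)) (x : QReg n), C.IsOracleFree ∧
    s = boolPair (QCircuit.sigmaEncode ⟨n, m, C⟩) (List.ofFn x) ∧ C.acceptProb 0 x ≤ (1 : ℝ) / 3}

/-- The universal family (X₃, verbatim) puts the gap-acceptance promise problem in `PromiseBQP`. [cite: Watrous2009, §III.2] -/
theorem apcPromise_mem_PromiseBQP
    (hU : ∃ U : Literature.Computability.Cryptography.QCircuitFamily Literature.Computability.Cryptography.cliffordT, U.IsOracleFree ∧ U.IsUniform ∧ ∀ (n m : ℕ) (C : Literature.Computability.Cryptography.QCircuit Literature.Computability.Cryptography.cliffordT (n + m)) (x : Literature.Computability.Cryptography.QReg n), C.IsOracleFree → ((2 : ℝ) / 3 ≤ C.acceptProb 0 x → (2 : ℝ) / 3 ≤ U.acceptProbOn 0 (Literature.Computability.Complexity.boolPair (Literature.Computability.Cryptography.QCircuit.sigmaEncode ⟨n, m, C⟩) (List.ofFn x))) ∧ (C.acceptProb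 0 x ≤ (1 : ℝ) / 3 → U.acceptProbOn 0 (Literature.Computability.Complexity.boolPair (Literature.Computability.Cryptography.QCircuit.sigmaEncode ⟨n, m, C⟩) (List.ofFn x)) ≤ (1 : ℝ) / 3)) : apcPromise ∈ PromiseBQP := by
  obtain ⟨U, hUo, hUu, hU⟩ := hU
  refine ⟨U, hUo, hUu, ?_, ?_⟩
  · rintro s ⟨n, m, C, x, hC, rfl, h⟩
    exact (hU n m C x hC).1 h
  · rintro s ⟨n, m, C, x, hC, rfl, h⟩
    exact (hU n m C x hC).2 h

/-- Cook–Reckhow (Prop. 1.4 pattern): a sound, polynomially bounded amplitude proof system puts the gap-acceptance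
promise problem in `PromiseNP` — the separating `NP` language is "`s` has a `V`-proof of length `≤ p |s|`" (X₁ verbatim as hypothesis). [cite: CookReckhow1979, §1 Prop. 1.4] -/
theorem apcPromise_mem_PromiseNP
    (h : ∃ V : List Bool → List Bool → Bool, Literature.Computability.MetaComplexity.IsPolyTimeVerifier V ∧ (∀ (n m : ℕ) (C : Literature.Computability.Cryptography.QCircuit Literature.Computability.Cryptography.cliffordT (n + m)) (x : Literature.Computability.Cryptography.QReg n) (π : List Bool), C.IsOracleFree → V (Literature.Computability.Complexity.boolPair (Literature.Computability.Cryptography.QCircuit.sigmaEncode ⟨n, m, C⟩) (List.ofFn x)) π = true → (1 : ℝ) / 3 < C.acceptProb 0 x) ∧ ∃ p : Polynomial ℕ, ∀ (n m : ℕ) (C : Literature.Computability.Cryptography.QCircuit Literature.Computability.Cryptography.cliffordT (n + m)) (x : Literature.Computability.Cryptography.QReg n), C.IsOracleFree → (2 : ℝ) / 3 ≤ C.acceptProb 0 x → ∃ π : List Bool, π.length ≤ p.eval (Literature.Computability.Complexity.boolPair (Literature.Computability.Cryptography.QCircuit.sigmaEncode ⟨n, m, C⟩) (List.ofFn x)).length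 ∧ V (Literature.Computability.Complexity.boolPair (Literature.Computability.Cryptography.QCircuit.sigmaEncode ⟨n, m, C⟩) (List.ofFn x)) π = true) : apcPromise ∈ PromiseNP := by
  obtain ⟨V, hV, hsound, p, hcomplete⟩ := h
  -- the witness language of `V`, in `P` by composing the machine of `V` after the re-pairing machine
  set L' : Language Bool := {w | Function.uncurry V (boolUnpair w) = true} with hL'
  have hL'P : L' ∈ P := by
    refine mem_P_iff_holds.2 (polyTimeDecidable_iff.2 ?_)
    have hcomp : PolyTimeComputable (id : List Bool → List Bool) encodeBool
        (Function.uncurry V ∘ boolUnpair) :=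
      PolyTimeComputable.comp_holds hV polyTimeComputable_boolUnpair
    have hind : L'.boolIndicator = Function.uncurry V ∘ boolUnpair := by
      funext w
      by_cases hw : Function.uncurry V (boolUnpair w) = true
      · rw [(Set.mem_iff_boolIndicator L' w).1 hw]
        exact hw.symm
      · rw [(Set.notMem_iff_boolIndicator L' w).1 hw]
        simp only [Function.comp_apply]
        cases h : Function.uncurry V (boolUnpair w)
        · rfl
        · exact absurd h hw
    rw [hind]
    exact hcomp
  have hmem : ∀ s π : List Bool, boolPair s π ∈ L' ↔ V s π = true := fun s π => by
    change Function.uncurry V (boolUnpair (boolPair s π)) = true ↔ _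
    rw [boolUnpair_boolPair]
    rfl
  -- the NP language of short proofs
  set L₁ : Language Bool := {s | ∃ π : List Bool, π.length ≤ p.eval s.length ∧ V s π = true} with hL₁
  have hL₁NP : L₁ ∈ NP := by
    refine ⟨L', hL'P, p, fun s => ?_⟩
    change (∃ π : List Bool, π.length ≤ p.eval s.length ∧ V s π = true) ↔ _
    simp only [hmem]
  refine ⟨L₁, hL₁NP, ?_, ?_⟩
  · rintro s ⟨n, m, C, x, hC, rfl, hacc⟩
    exact hcomplete n m C x hC hacc
  · rintro s ⟨n, m, C, x, hC, rfl, hacc⟩ ⟨π, -, hπ⟩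
    have := hsound n m C x π hC hπ
    linarith

/-- **Glue of the strategist's split of `ApcThesis`** ("cut along NP", BC2 redirect of the restated deciding crux
stmt-QuantumAdvantage-2697): `ApcPolyBounded → ApcCertifiedCollapse → ApcUniversal → ApcThesis`, the three hypotheses
written out verbatim and in the order of the children installed by `route edit --split ApcThesis` (so the generated glue
item is closed by `exact apcThesis_of_subs`, definitional unfolding of the three route decls).  Cook–Reckhow Prop. 1.4 pattern: the gap-acceptance
promise problem is in `PromiseBQP ∩ PromiseNP` (lemmas above), hence in `PromiseP` with a separator `D ∈ P`; the new
verifier ignores its proof and decides `D` on the first component (`preimage_mem_P`, `Brick.fstF_mem_FP`), the finder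
is the constant empty proof (`const_mem_FP`). [cite: CookReckhow1979, §1 Prop. 1.4] [cite: Watrous2009, §III.2]
[cite: Goldreich2006, Def. 1.2–1.3] -/
theorem apcThesis_of_subs
    (h₁ : ∃ V : List Bool → List Bool → Bool, Literature.Computability.MetaComplexity.IsPolyTimeVerifier V ∧ (∀ (n m : ℕ) (C : Literature.Computability.Cryptography.QCircuit Literature.Computability.Cryptography.cliffordT (n + m)) (x : Literature.Computability.Cryptography.QReg n) (π : List Bool), C.IsOracleFree → V (Literature.Computability.Complexity.boolPair (Literature.Computability.Cryptography.QCircuit.sigmaEncode ⟨n, m, C⟩) (List.ofFn x)) π = true → (1 : ℝ) / 3 < C.acceptProb 0 x) ∧ ∃ p : Polynomial ℕ, ∀ (n m : ℕ) (C : Literature.Computability.Cryptography.QCircuit Literature.Computability.Cryptography.cliffordT (n + m)) (x : Literature.Computability.Cryptography.QReg n), C.IsOracleFree → (2 : ℝ) / 3 ≤ C.acceptProb 0 x → ∃ π : List Bool, π.length ≤ p.eval (Literature.Computability.Complexity.boolPair (Literature.Computability.Cryptography.QCircuit.sigmaEncode ⟨n, m, C⟩) (List.ofFn x)).length ∧ V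 (Literature.Computability.Complexity.boolPair (Literature.Computability.Cryptography.QCircuit.sigmaEncode ⟨n, m, C⟩) (List.ofFn x)) π = true)
    (h₂ : Literature.Computability.Cryptography.PromiseBQP ∩ Literature.Computability.Complexity.PromiseNP ⊆ Literature.Computability.Complexity.PromiseP)
    (hU : ∃ U : Literature.Computability.Cryptography.QCircuitFamily Literature.Computability.Cryptography.cliffordT, U.IsOracleFree ∧ U.IsUniform ∧ ∀ (n m : ℕ) (C : Literature.Computability.Cryptography.QCircuit Literature.Computability.Cryptography.cliffordT (n + m)) (x : Literature.Computability.Cryptography.QReg n), C.IsOracleFree → ((2 : ℝ) / 3 ≤ C.acceptProb 0 x → (2 : ℝ) / 3 ≤ U.acceptProbOn 0 (Literature.Computability.Complexity.boolPair (Literature.Computability.Cryptography.QCircuit.sigmaEncode ⟨n, m, C⟩) (List.ofFn x))) ∧ (C.acceptProb 0 x ≤ (1 : ℝ) / 3 → U.acceptProbOn 0 (Literature.Computability.Complexity.boolPair (Literature.Computability.Cryptography.QCircuit.sigmaEncode ⟨n, m, C⟩) (List.ofFn x)) ≤ (1 : ℝ) / 3)) :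
    ApcThesis := by
  -- the promise problem is in PromiseBQP ∩ PromiseNP, hence in PromiseP
  obtain ⟨D, hDP, hyes, hno⟩ := h₂ ⟨apcPromise_mem_PromiseBQP hU, apcPromise_mem_PromiseNP h₁⟩
  -- the pair language `{⟨s, π⟩ | s ∈ D}` is in `P` (preimage of `D` under the first projection)
  set W : Language Bool := Brick.fstF ⁻¹' D with hW
  have hWP : W ∈ P := preimage_mem_P hDP Brick.fstF_mem_FP
  have hmemW : ∀ s π : List Bool, boolPair s π ∈ W ↔ s ∈ D := fun s π => by
    change Brick.fstF (boolPair s π) ∈ D ↔ s ∈ D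
    rw [Brick.fstF_boolPair]
  obtain ⟨q, M, hM⟩ := polyTimeDecidable_iff.1 (mem_P_iff_holds.1 hWP)
  -- the verifier ignores its proof and decides `D`; the finder outputs the empty proof
  refine ⟨fun s π => W.boolIndicator (boolPair s π), fun _ => [],
    ⟨q, M, fun pr => hM (boolPair pr.1 pr.2)⟩, const_mem_FP [], ?_, ?_⟩
  · intro n m C x π hC hVtrue
    have hsD := (hmemW _ π).1 ((Set.mem_iff_boolIndicator W _).2 hVtrue)
    by_contra hle
    exact hno ⟨n, m, C, x, hC, rfl, not_lt.1 hle⟩ hsD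
  · intro n m C x hC hacc
    have hsD := hyes ⟨n, m, C, x, hC, rfl, hacc⟩
    exact (Set.mem_iff_boolIndicator W _).1 ((hmemW _ []).2 hsD)

end Summit.QuantumAdvantage.QuantumAdvantage.Theorems
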